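import Literature.MathematicalPhysics.QuantumFieldTheory.Balaban1983to89.B9Eq342CombesThomasFormZd
import Literature.MathematicalPhysics.QuantumFieldTheory.Balaban1983to89.B9Thm311PosDefNearFlatZd

/-!
# `Balaban1983to89.B9Thm31GpDecayOfCoerciveZd` — [Balaban1985BackgroundPropagators] Thm 3.1 p. 397 ∕ (3.42) p. 397 FOR THE GENUINE `G′(U₀) = (Ω₀Δ′_a(U₀)Ω₀)⁻¹`
# OF (3.24) AT THE `ℤᵈ` CARRIER, n = 0 SHAPE, FROM ONE DISPLAYED COERCIVITY CONSTANT: the FIELD-locality of `Δ′_a(U₀)` (range `Lᵐ` in the `ℓ∞` site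
# distance), its block bound `4d∕η² + Σ_{j≤m} a_j` (unitary background and averaged transporters), the ball count `(2Lᵐ+1)ᵈ`, and then
# ★★★ `|(G′(U₀)δ_y w)(x)|_τ ≤ e^{−κ|x−y|_∞}·|w|_τ ∕ (c − ϱ)` by the Combes–Thomas engine `B9Eq342CombesThomasFormZd`

statement-level skeleton of published theorems with citation tags; proofs where landed; nothing here is a claim about the
Yang–Mills mass gap

`[Balaban1985BackgroundPropagators]` ("B9", CMP **99** (1985) 389–434): Thm 3.1 p. 397 *«G′(U) … satisfies |(G′(U)f)(x)| ≤ O(1)(Lʲη)²e^{−δ₀d(y,y′)}|f| (3.42) …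
uniformly in U, Ω_j»* for `U` in the class (3.35); (3.24) p. 394 (`Δ′_a = (Δ^η_U + Q′*aQ′)↾Ω₀`, `G′ = (Δ′_a)⁻¹`); (3.23) p. 394 (`Δ^η_U`); (3.19) p. 393 (`Q′_j(U)`); Thm 3.11
p. 416 («Δ′_a, G′ … positive definite»); [Balaban1984PropagatorsII] p. 226 («bounded from below by a positive constant»).  Print obtains (3.42) from the
random-walk expansion of Sect. B with the (3.35) gauge `U = e^{iηA}`; HERE the n = 0 entry's SHAPE is obtained at a finite member from the coercivity
constant of `Δ′_a(U₀)` ALONE (displayed as `hco`, exactly dag-n06-w4 g4's CLAIM-2 conclusion) by the Combes–Thomas conjugation — the route's substitute, not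
print's proof; print's rate `δ₀` and weights `(Lʲη)²` are NOT claimed.

CITATION HEADER (lean-in-tree rule).  Cell `pub-ymgap` (YM Track A, HUMAN RULING D-0062 ∕ D-0149 width push), DAG node N06 = [B9], width seat
`pub-ymgap-dag-n06-w2` (g4), CLAIM-1 FILE B («Combes–Thomas at the ℤᵈ frame, station 1»).  Inputs BY NAME: the engine (this seat, FILE A), dag-n06-w4 g2's
`deltaPrimeADom ∕ GpZd ∕ deltaPrimeADom_GpZd ∕ transposeOn ∕ re_trace_transposeOn ∕ QprimeLin ∕ deltaPrimeAZd_apply ∕ deltaPrimeADom_coe`, dag-n06-w4 g3's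
`B9Thm311PosDefNearFlatZd.bgT_mem_unitaryUnits_of_reg17UnivP` ([5] Prop. 2 on the regime `𝒰′`), `B7Eq78Linearization.QprimeIter ∕ Qprime ∕ zdBlocking`,
`QuantumLattice.blockSites ∕ blockMap`, `LatticeNorms.linfDist`.  Nothing restated.

WHAT IS PROVED (kernel, 0 sorry, 0 def; no `instance`, no `notation`).
* §1 geometry: `abs_sub_le_of_blockMap_eq` ∕ ★ `linfDist_le_of_blockMap_iterate_eq` (two sites with the same `j`-fold block index are within `Lʲ − 1` in `ℓ∞`),
  `card_filter_linfDist_le` (`#{y ∈ s : |x − y|_∞ ≤ R} ≤ (2R+1)ᵈ`).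
* §2 the fibre size under the letters: `fnorm_conjR_of_unitary` (`|R(u)a|_τ = |a|_τ`, unitary `u`, tracial `τ`), `fnorm_neg'`, `fnorm_sub_le`.
* §3 FIELD-LOCALITY AND SIZE OF `Q′_j(U₀)` ON A SINGLE-SITE FUNCTION: ★ `QprimeIter_single_eq_zero` (`(Q′_jδ_y w)(c) = 0` unless `c` is the `j`-fold block index of
  `y`), ★ `fnorm_QprimeIter_single_le` (`|(Q′_jδ_y w)(c)|_τ ≤ |w|_τ` for unitary transporters, `L ≥ 1`); the transpose: ★ `fnorm_transposeOn_le_of_bound` (Riesz: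
  a functional bounded by `C|X|_τ` has Riesz vector of size `≤ C`), ★★ `fnorm_transposeOn_QprimeLin_single_le` (`|(Q′_jᵀ Q′_j δ_y w)(x)|_τ ≤ |w|_τ`) and
  `transposeOn_QprimeLin_single_eq_zero` (`= 0` unless `x, y` share the `j`-fold block index).
* §4 FIELD-LOCALITY AND SIZE OF `Δ^η_{U₀}` ON A SINGLE-SITE FUNCTION: `covLap_single_eq_zero` (vanishes unless `|x − y|_∞ ≤ 1`), ★ `fnorm_covLap_single_le`
  (`≤ 4d·η⁻²·|w|_τ`, unitary `U₀`).
* §5 the blocks of `Ω₀Δ′_a(U₀)Ω₀`: ★★ `blockAt_deltaPrimeADom_eq_zero` (range `Lᵐ`), ★★ `fnorm_blockAt_deltaPrimeADom_le` (block bound `4d∕η² + Σ_{j≤m} a_j`).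
* §6 ★★★ `fnorm_GpZd_single_le_exp_of_coercive` — for EVERY unitary `U₀` with unitary averaged transporters (`bgT`, levels `≤ m`), `a ≥ 0`, finite `Ω₀ = s`, and a
  DISPLAYED coercivity constant `hco : ∀ f, c·⟨f,f⟩_τ ≤ ⟨f, Ω₀Δ′_a(U₀)Ω₀ f⟩_τ`: for `κ ≥ 0` with `ϱ := (4d∕η² + Σ_{j≤m} a_j)(2Lᵐ+1)ᵈ(e^{κLᵐ} − 1) < c`,
  `|(G′(U₀)δ_y w)(x)|_τ ≤ e^{−κ|x−y|_∞}·|w|_τ ∕ (c − ϱ)` (`y ∈ Ω₀`, all `x`); ★★★ `…_of_reg17UnivP` — the same on dag-n06-w2 g3's regime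
  `𝒰′ = {U₀ unitary ∧ Reg17 L m univ (α_Q∕L²)}` (transporters unitary by dag-n06-w4 g3's [5] Prop. 2 lemma; `2 ≤ L`, `0 < d`).

HONEST SCOPE.  (i) A REDUCTION of the n = 0 entry of (3.42) for `G′` to the coercivity constant `c` (print: Thm 3.11 ∕ Sect. B): `c` is DISPLAYED, not proved here
(dag-n06-w4 g4 CLAIM-2 supplies it per member by compactness — member-dependent, non-quantitative); the constant `1∕(c − ϱ)` and the rate `κ` are the
window's, NOT print's `O(1)(Lʲη)²` ∕ `δ₀`; nothing is uniform in the member.  (ii) Block bounds are crude (`4d∕η²`, `|a_j|·1`), range `Lᵐ` in fine sites.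
(iii) Count-neutral; N05 ∕ N06 NOT discharged; K1⁸ `stmt-QuantumFields-26907` NOT closed; one finite `𝕋⁴` programme at fixed `ε`, Bałaban as printed; R4 closes
only the conditional finite-`𝕋⁴` rung `BalabanLadder.UV` — nothing continuum ∕ ℝ⁴ ∕ OS ∕ mass gap ∕ Clay.  Unit `pub-ymgap-dag-n06-w2` (g4), 2026-08-28.
-/

noncomputable section

open scoped BigOperators

namespace Literature.MathematicalPhysics.QuantumFieldTheory.Balaban1983to89.B9Thm31GpDecayOfCoerciveZd

open Literature.MathematicalPhysics.QuantumLattice (blockSites blockBase blockMap mem_blockSites_iff)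
open B7Prop1Explicit (e)
open B7Eq78Linearization (conjR conjR_apply QprimeIter QprimeIter_zero QprimeIter_succ Qprime_apply zdBlocking)
open B7Prop2Explicit (unitaryUnits)
open B8Ineq132 (covDerivFwd covDeriv)
open B8Eq119TwistedAxial (bgT)
open B8Eq138LandauZd (covDivB covLap)
open B9Eq321LandauProjectionZd (suppSub formE formE_apply)
open B9Eq324DeltaPrimeAZd (fibreForm fibreForm_apply single eq_sum_single restrictSite restrictSite_coe transposeOn re_trace_transposeOn QprimeLin
  QprimeLin_apply deltaPrimeAZd deltaPrimeAZd_apply deltaPrimeADom deltaPrimeADom_coe GpZd deltaPrimeADom_GpZd fibreForm_riesz)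
open B9Eq326GaugeTermSquareZd (re_trace_star_pair_invariant)
open B9Eq316AveragingTransposeZd (Reg17 alphaQ)
open B9Eq342CombesThomasFormZd
open LatticeNorms (linfDist linfDist_le_iff natAbs_sub_le_linfDist)

export B7Prop1Explicit (Site)

variable {d : ℕ} {𝔸 : Type*} [CStarAlgebra 𝔸]

/-! ## §1  Geometry: common block index ⟹ `ℓ∞`-close; the `ℓ∞` ball count -/

section Geometry

/-- sites with the same block index are within `L − 1` coordinatewise (`x = L⌊x∕L⌋ + r`, `0 ≤ r ≤ L − 1`). [folklore]
[cite: Balaban1985Averaging, (78) p.30 («B(y) … Lᵈ sites»; bookkeeping)] -/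
theorem abs_sub_le_of_blockMap_eq {L : ℕ} (hL : 1 ≤ L) {x y : Site d} (h : blockMap L x = blockMap L y) (i : Fin d) :
    |x i - y i| ≤ (L : ℤ) - 1 := by
  have hL0 : (0 : ℤ) < L := by exact_mod_cast hL
  have hq : x i / (L : ℤ) = y i / (L : ℤ) := congr_fun h i
  have hx := Int.emod_add_mul_ediv (x i) L
  have hy := Int.emod_add_mul_ediv (y i) L
  have hx0 := Int.emod_nonneg (x i) hL0.ne'
  have hy0 := Int.emod_nonneg (y i) hL0.ne'
  have hx1 := Int.emod_lt_of_pos (x i) hL0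
  have hy1 := Int.emod_lt_of_pos (y i) hL0
  rw [abs_le]
  constructor <;> nlinarith

/-- one coarse-graining step: `|x − y| ≤ L·|⌊x∕L⌋ − ⌊y∕L⌋| + (L − 1)` in each coordinate. [folklore]
[cite: Balaban1985Averaging, (78) p.30 (bookkeeping)] -/
theorem abs_sub_le_mul_abs_ediv_sub {L : ℕ} (hL : 1 ≤ L) (u v : ℤ) :
    |u - v| ≤ (L : ℤ) * |u / (L : ℤ) - v / (L : ℤ)| + ((L : ℤ) - 1) := by
  have hL0 : (0 : ℤ) < L := by exact_mod_cast hL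
  have hx := Int.emod_add_mul_ediv u L
  have hy := Int.emod_add_mul_ediv v L
  have hx0 := Int.emod_nonneg u hL0.ne'
  have hy0 := Int.emod_nonneg v hL0.ne'
  have hx1 := Int.emod_lt_of_pos u hL0
  have hy1 := Int.emod_lt_of_pos v hL0
  have hdec : u - v = (u % L - v % L) + (L : ℤ) * (u / L - v / L) := by linarith
  rw [hdec]
  refine (abs_add_le _ _).trans ?_
  rw [abs_mul, abs_of_pos hL0]
  have hr : |u % (L : ℤ) - v % (L : ℤ)| ≤ (L : ℤ) - 1 := by rw [abs_le]; constructor <;> linarith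
  linarith

/-- ★ **SITES WITH THE SAME `j`-FOLD BLOCK INDEX ARE `ℓ∞`-CLOSE**: `(blockMap L)^[j] x = (blockMap L)^[j] y ⟹ |x − y|_∞ ≤ Lʲ − 1` (`L ≥ 1`) — the fine sites under
one level-`j` site form an `Lʲ`-box. [folklore] [cite: Balaban1985Averaging, (78) p.30; Balaban1985BackgroundPropagators, (3.19) p.393 (bookkeeping)] -/
theorem linfDist_le_of_blockMap_iterate_eq {L : ℕ} (hL : 1 ≤ L) :
    ∀ (j : ℕ) {x y : Site d}, (blockMap L)^[j] x = (blockMap L)^[j] y → linfDist x y + 1 ≤ L ^ j := by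
  intro j
  induction j with
  | zero =>
    intro x y h
    have hxy : x = y := h
    subst hxy
    simp
  | succ j ih =>
    intro x y h
    have h' : (blockMap L)^[j] (blockMap L x) = (blockMap L)^[j] (blockMap L y) := by
      rw [← Function.iterate_succ_apply, ← Function.iterate_succ_apply]; exact h
    have hIH := ih h'
    have hcoord : ∀ μ, (x μ - y μ).natAbs + 1 ≤ L ^ (j + 1) := by
      intro μ
      have hq : ((blockMap L x) μ - (blockMap L y) μ).natAbs + 1 ≤ L ^ j := by
        have := natAbs_sub_le_linfDist (blockMap L x) (blockMap L y) μ
        omega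
      dsimp only [blockMap] at hq
      have hqZ : |x μ / (L : ℤ) - y μ / (L : ℤ)| + 1 ≤ ((L : ℤ) ^ j) := by
        have h1 : (((x μ / (L : ℤ) - y μ / (L : ℤ)).natAbs : ℤ) + 1 ≤ ((L ^ j : ℕ) : ℤ)) := by exact_mod_cast hq
        rw [Int.natCast_natAbs] at h1
        push_cast at h1
        exact h1
      have hstep := abs_sub_le_mul_abs_ediv_sub hL (x μ) (y μ)
      have hL0 : (0 : ℤ) ≤ L := by positivity
      have hmul : (L : ℤ) * |x μ / (L : ℤ) - y μ / (L : ℤ)| ≤ (L : ℤ) * ((L : ℤ) ^ j - 1) :=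
        mul_le_mul_of_nonneg_left (by linarith) hL0
      have key : |x μ - y μ| + 1 ≤ (L : ℤ) ^ (j + 1) := by rw [pow_succ]; nlinarith
      have h2 : (((x μ - y μ).natAbs : ℤ) + 1 ≤ ((L ^ (j + 1) : ℕ) : ℤ)) := by
        rw [Int.natCast_natAbs]; push_cast; exact key
      exact_mod_cast h2
    have hpos : 1 ≤ L ^ (j + 1) := Nat.one_le_pow _ _ hL
    have : linfDist x y ≤ L ^ (j + 1) - 1 := by
      rw [linfDist_le_iff]
      intro μ
      have := hcoord μ
      omega
    omega

/-- **THE `ℓ∞` BALL COUNT ON `ℤᵈ`**: `#{y ∈ s : |x − y|_∞ ≤ R} ≤ (2R + 1)ᵈ`. [folklore] [cite: Balaban1984PropagatorsII, (2.46) p.231 (bookkeeping)] -/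
theorem card_filter_linfDist_le (s : Finset (Site d)) (x : Site d) (R : ℕ) :
    (s.filter (fun y => linfDist x y ≤ R)).card ≤ (2 * R + 1) ^ d := by
  classical
  have hsub : s.filter (fun y => linfDist x y ≤ R) ⊆ Finset.Icc (fun μ => x μ - (R : ℤ)) (fun μ => x μ + (R : ℤ)) := by
    intro y hy
    rw [Finset.mem_filter] at hy
    rw [Finset.mem_Icc]
    have h := (linfDist_le_iff x y R).1 hy.2
    constructor <;> intro μ <;> have hμ := h μ <;> simp only <;> omega
  refine (Finset.card_le_card hsub).trans (le_of_eq ?_)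
  rw [Pi.card_Icc]
  simp only [Int.card_Icc]
  have h : ∀ μ : Fin d, (x μ + (R : ℤ) + 1 - (x μ - (R : ℤ))).toNat = 2 * R + 1 := fun μ => by omega
  simp only [h, Finset.prod_const, Finset.card_univ, Fintype.card_fin]

end Geometry

/-! ## §2  The fibre size under the letters: conjugation by unitaries, negation, differences -/

section FibreLetters

variable (τ : 𝔸 →ₗ[ℂ] ℂ)

/-- **`|R(u)a|_τ = |a|_τ`** for a unitary unit `u` and a tracial `τ` (`Re τ((uau⁻¹)* uau⁻¹) = Re τ(a*a)`). [cite: Balaban1985BackgroundPropagators, (3.28) p.395, p.391] -/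
theorem fnorm_conjR_of_unitary (hτt : ∀ a b : 𝔸, τ (a * b) = τ (b * a)) {u : 𝔸ˣ} (hu : u ∈ unitaryUnits 𝔸) (a : 𝔸) :
    fnorm τ (conjR u a) = fnorm τ a := by
  unfold fnorm
  rw [re_trace_star_pair_invariant τ hτt hu a (conjR u a)]
  congr 2
  rw [conjR_apply, conjR_apply]
  simp [mul_assoc]

/-- `|−a|_τ = |a|_τ`. [cite: Balaban1985BackgroundPropagators, p.390 (bookkeeping)] -/
theorem fnorm_neg' (a : 𝔸) : fnorm τ (-a) = fnorm τ a := by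
  unfold fnorm
  rw [star_neg, neg_mul_neg]

/-- `|a − b|_τ ≤ |a|_τ + |b|_τ`. [cite: Balaban1985BackgroundPropagators, p.390 (bookkeeping)] -/
theorem fnorm_sub_le (hτp : ∀ a : 𝔸, a ≠ 0 → 0 < (τ (star a * a)).re) (hτs : ∀ a : 𝔸, τ (star a) = starRingEnd ℂ (τ a)) (a b : 𝔸) :
    fnorm τ (a - b) ≤ fnorm τ a + fnorm τ b := by
  rw [sub_eq_add_neg]
  exact (fnorm_add_le hτp hτs a (-b)).trans (by rw [fnorm_neg'])

/-- `|single y w c|_τ ≤ |w|_τ`. [cite: Balaban1985BackgroundPropagators, (3.24) p.394 (bookkeeping)] -/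
theorem fnorm_single_le (y c : Site d) (w : 𝔸) : fnorm τ (single y w c) ≤ fnorm τ w := by
  by_cases h : c = y
  · subst h; rw [single_apply_self]
  · rw [single_apply_of_ne h, fnorm_zero]; exact fnorm_nonneg τ w

end FibreLetters

/-! ## §3  Field-locality and size of `Q′_j(U₀)` and of its transpose on a single-site function -/

section Averaging

variable (τ : 𝔸 →ₗ[ℂ] ℂ) {L : ℕ} (T : ℕ → Site d → Site d → 𝔸ˣ)

/-- ★ **`(Q′_j δ_y w)(c) = 0` UNLESS `c = (blockMap L)^[j] y`** (`L ≥ 1`): the `j`-fold average of a single-site function lives at the one level-`j` site above `y`.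
[cite: Balaban1985BackgroundPropagators, (3.19) p.393; Balaban1985Averaging, (78) p.30] -/
theorem QprimeIter_single_eq_zero (hL : 1 ≤ L) (y : Site d) (w : 𝔸) :
    ∀ (j : ℕ) (c : Site d), c ≠ (blockMap L)^[j] y → QprimeIter (zdBlocking d L) T j (single y w) c = 0 := by
  haveI : NeZero L := ⟨by omega⟩
  intro j
  induction j with
  | zero => intro c hc; simpa using single_apply_of_ne (by simpa using hc) w
  | succ j ih =>
    intro c hc
    rw [QprimeIter_succ, Qprime_apply]
    refine Finset.sum_eq_zero fun x hx => ?_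
    change x ∈ blockSites L c at hx
    have hxc : blockMap L x = c := (mem_blockSites_iff L c x).1 hx
    have hx' : x ≠ (blockMap L)^[j] y := by
      intro hxy
      apply hc
      rw [Function.iterate_succ_apply', ← hxy, hxc]
    rw [ih x hx', map_zero_conj, smul_zero]
where
  /-- `R(t) 0 = 0`. -/
  map_zero_conj {t : 𝔸ˣ} : conjR t (0 : 𝔸) = 0 := by rw [conjR_apply, mul_zero, zero_mul]

/-- ★ **`|(Q′_j δ_y w)(c)|_τ ≤ |w|_τ`** for unitary transporters at the levels `< j` and `L ≥ 1` (weights `L⁻ᵈ ≤ 1`, conjugations isometric for `|·|_τ`, one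
non-zero summand). [cite: Balaban1985BackgroundPropagators, (3.19) p.393; Balaban1985Averaging, (78) p.30, Prop. 2 p.26] -/
theorem fnorm_QprimeIter_single_le (hτt : ∀ a b : 𝔸, τ (a * b) = τ (b * a)) (hL : 1 ≤ L) (y : Site d) (w : 𝔸) :
    ∀ j : ℕ, (∀ j', j' < j → ∀ c x, T j' c x ∈ unitaryUnits 𝔸) → ∀ c : Site d, fnorm τ (QprimeIter (zdBlocking d L) T j (single y w) c) ≤ fnorm τ w := by
  haveI : NeZero L := ⟨by omega⟩
  intro j
  induction j with
  | zero => intro _ c; simpa using fnorm_single_le τ y c w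
  | succ j ih =>
    intro hT c
    have hTj : ∀ j', j' < j → ∀ c x, T j' c x ∈ unitaryUnits 𝔸 := fun j' hj' => hT j' (Nat.lt_succ_of_lt hj')
    rw [QprimeIter_succ, Qprime_apply]
    classical
    -- the one possibly non-zero summand sits at `x₀ = (blockMap L)^[j] y`
    set x₀ := (blockMap L)^[j] y with hx₀
    have hvan : ∀ x ∈ blockSites L c, x ≠ x₀ → (zdBlocking d L).wt j c x • conjR (T j c x) (QprimeIter (zdBlocking d L) T j (single y w) x) = 0 := by
      intro x _ hx
      rw [QprimeIter_single_eq_zero T hL y w j x hx, QprimeIter_single_eq_zero.map_zero_conj, smul_zero]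
    have hB : (zdBlocking d L).B j c = blockSites L c := rfl
    rw [hB]
    by_cases hmem : x₀ ∈ blockSites L c
    · rw [Finset.sum_eq_single_of_mem x₀ hmem (fun x hx hne => hvan x hx hne)]
      have hwt : (zdBlocking d L).wt j c x₀ = ((L : ℝ) ^ d)⁻¹ := rfl
      rw [hwt, fnorm_smul, fnorm_conjR_of_unitary τ hτt (hT j (Nat.lt_succ_self j) c x₀)]
      have hLd : (1 : ℝ) ≤ (L : ℝ) ^ d := one_le_pow₀ (by exact_mod_cast hL)
      have hinv : |((L : ℝ) ^ d)⁻¹| ≤ 1 := by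
        rw [abs_of_pos (by positivity)]
        exact inv_le_one_of_one_le₀ hLd
      calc |((L : ℝ) ^ d)⁻¹| * fnorm τ (QprimeIter (zdBlocking d L) T j (single y w) x₀)
          ≤ 1 * fnorm τ w := mul_le_mul hinv (ih hTj x₀) (fnorm_nonneg τ _) zero_le_one
        _ = fnorm τ w := one_mul _
    · rw [Finset.sum_eq_zero (fun x hx => hvan x hx (fun h => hmem (h ▸ hx))), fnorm_zero]
      exact fnorm_nonneg τ w

variable [FiniteDimensional ℝ 𝔸] (hτp : ∀ a : 𝔸, a ≠ 0 → 0 < (τ (star a * a)).re)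

/-- ★ **RIESZ: A FUNCTIONAL BOUNDED BY `C|X|_τ` HAS TRANSPOSE VALUE OF SIZE `≤ C`** — if `|Σ_{c∈Λ} Re τ((S(δ_x X))(c)* g(c))| ≤ C·|X|_τ` for all `X`, then
`|(Sᵀ_Λ g)(x)|_τ ≤ C`. [cite: Balaban1985BackgroundPropagators, (3.24) p.394 («defined by the same quadratic form»), p.391 («the adjoints …»)] -/
theorem fnorm_transposeOn_le_of_bound (S : (Site d → 𝔸) →ₗ[ℝ] (Site d → 𝔸)) (Λ : Finset (Site d)) (g : Site d → 𝔸) (x : Site d) {C : ℝ}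
    (hC : 0 ≤ C) (hb : ∀ X : 𝔸, |∑ c ∈ Λ, (τ (star (S (single x X) c) * g c)).re| ≤ C * fnorm τ X) :
    fnorm τ (transposeOn τ hτp S Λ g x) ≤ C := by
  set v := transposeOn τ hτp S Λ g x with hv
  have hsq : fnorm τ v ^ 2 ≤ C * fnorm τ v := by
    rw [fnorm_sq hτp, hv, re_trace_transposeOn]
    exact (le_abs_self _).trans (hb _)
  by_cases h0 : fnorm τ v = 0
  · rw [h0]; exact hC
  · have hpos : 0 < fnorm τ v := lt_of_le_of_ne (fnorm_nonneg τ v) (Ne.symm h0)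
    nlinarith

variable {U₀ : Site d → Fin d → 𝔸ˣ}

/-- ★★ **`|(Q′_jᵀ_{Λ_j} Q′_j δ_y w)(x)|_τ ≤ |w|_τ`** (unitary averaged transporters at the levels `< j`, `L ≥ 1`, faithful Hermitian tracial `τ`), and
**`= 0` UNLESS `x` AND `y` SHARE THE `j`-FOLD BLOCK INDEX** — the penalty `Q′*aQ′` of (3.24) is block-diagonal over the level-`j` blocks.
[cite: Balaban1985BackgroundPropagators, (3.24) p.394, (3.19) p.393] -/
theorem fnorm_transposeOn_QprimeLin_single_le (hτt : ∀ a b : 𝔸, τ (a * b) = τ (b * a)) (hτs : ∀ a : 𝔸, τ (star a) = starRingEnd ℂ (τ a))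
    (hL : 1 ≤ L) {j : ℕ} (hT : ∀ j', j' < j → ∀ c x, bgT L U₀ j' c x ∈ unitaryUnits 𝔸) (Λ : Finset (Site d)) (y : Site d) (w : 𝔸) (x : Site d) :
    fnorm τ (transposeOn τ hτp (QprimeLin L U₀ j) Λ (QprimeIter (zdBlocking d L) (bgT L U₀) j (single y w)) x) ≤
        (if (blockMap L)^[j] x = (blockMap L)^[j] y then fnorm τ w else 0) := by
  classical
  set g := QprimeIter (zdBlocking d L) (bgT L U₀) j (single y w) with hg
  set cx := (blockMap L)^[j] x with hcx
  refine fnorm_transposeOn_le_of_bound τ hτp _ Λ g x (by split_ifs <;> [exact fnorm_nonneg τ w; exact le_rfl]) fun X => ?_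
  -- only `c = cx` contributes, and there `|…| ≤ |X|_τ·|g(cx)|_τ`
  have hterm : ∀ c ∈ Λ, |(τ (star (QprimeLin L U₀ j (single x X) c) * g c)).re| ≤
      (if c = cx then fnorm τ X * fnorm τ (g c) else 0) := by
    intro c _
    by_cases hc : c = cx
    · rw [if_pos hc]
      refine (abs_fibreForm_le hτp hτs _ _).trans (mul_le_mul_of_nonneg_right ?_ (fnorm_nonneg τ _))
      rw [QprimeLin_apply]
      exact fnorm_QprimeIter_single_le τ (bgT L U₀) hτt hL x X j hT c
    · rw [if_neg hc, QprimeLin_apply, QprimeIter_single_eq_zero (bgT L U₀) hL x X j c hc, star_zero, zero_mul, map_zero, Complex.zero_re, abs_zero]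
  have hgc : fnorm τ (g cx) ≤ (if (blockMap L)^[j] x = (blockMap L)^[j] y then fnorm τ w else 0) := by
    split_ifs with hxy
    · exact fnorm_QprimeIter_single_le τ (bgT L U₀) hτt hL y w j hT cx
    · rw [hg, QprimeIter_single_eq_zero (bgT L U₀) hL y w j cx (by rw [hcx]; exact hxy), fnorm_zero]
  calc |∑ c ∈ Λ, (τ (star (QprimeLin L U₀ j (single x X) c) * g c)).re|
      ≤ ∑ c ∈ Λ, |(τ (star (QprimeLin L U₀ j (single x X) c) * g c)).re| := Finset.abs_sum_le_sum_abs _ _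
    _ ≤ ∑ c ∈ Λ, (if c = cx then fnorm τ X * fnorm τ (g c) else 0) := Finset.sum_le_sum hterm
    _ ≤ fnorm τ X * fnorm τ (g cx) := by
        rw [Finset.sum_ite_eq']
        split_ifs
        · exact le_rfl
        · exact mul_nonneg (fnorm_nonneg τ _) (fnorm_nonneg τ _)
    _ ≤ (if (blockMap L)^[j] x = (blockMap L)^[j] y then fnorm τ w else 0) * fnorm τ X := by
        rw [mul_comm]; exact mul_le_mul_of_nonneg_right hgc (fnorm_nonneg τ _)

end Averaging

/-! ## §4  Field-locality and size of the covariant Laplacian `Δ^η_{U₀}` on a single-site function -/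

section Laplacian

variable (τ : 𝔸 →ₗ[ℂ] ℂ) {η : ℝ} {U₀ : Site d → Fin d → 𝔸ˣ}

/-- the Laplacian of (3.23), spelled out termwise. [cite: Balaban1985BackgroundPropagators, (3.23) p.394; Balaban1985RegularSpaces, (1.1) p.76] -/
theorem covLap_apply (f : Site d → 𝔸) (x : Site d) :
    covLap η U₀ f x = ∑ μ : Fin d, η⁻¹ • (conjR (U₀ (x - e μ) μ)⁻¹ (η⁻¹ • (conjR (U₀ (x - e μ) μ) (f x) - f (x - e μ))) -
      η⁻¹ • (conjR (U₀ x μ) (f (x + e μ)) - f x)) := by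
  simp only [covLap, covDivB, covDeriv, covDerivFwd, sub_add_cancel]

/-- **`(Δ^η_{U₀} δ_y w)(x) = 0` UNLESS `|x − y|_∞ ≤ 1`** (the Laplacian reads `f` at `x`, `x ± e_μ`). [cite: Balaban1985BackgroundPropagators, (3.23) p.394] -/
theorem covLap_single_eq_zero (y : Site d) (w : 𝔸) {x : Site d} (hfar : 1 < linfDist x y) : covLap η U₀ (single y w) x = 0 := by
  have hne : ∀ z : Site d, linfDist z x ≤ 1 → single y w z = 0 := by
    intro z hz
    apply single_apply_of_ne
    intro hzy
    subst hzy
    rw [LatticeNorms.linfDist_comm] at hz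
    omega
  have h0 : single y w x = 0 := hne x (by rw [LatticeNorms.linfDist_self]; omega)
  have hp : ∀ μ, single y w (x + e μ) = 0 := fun μ => hne _ (by
    rw [linfDist_le_iff]; intro ν; simp only [Pi.add_apply, B7Prop1Explicit.e_apply]; split_ifs <;> simp)
  have hm : ∀ μ, single y w (x - e μ) = 0 := fun μ => hne _ (by
    rw [linfDist_le_iff]; intro ν; simp only [Pi.sub_apply, B7Prop1Explicit.e_apply]; split_ifs <;> simp)
  rw [covLap_apply]
  refine Finset.sum_eq_zero fun μ _ => ?_
  rw [h0, hp, hm]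
  simp [conjR_apply]

/-- ★ **`|(Δ^η_{U₀} δ_y w)(x)|_τ ≤ 4d·η⁻²·|w|_τ`** for a UNITARY background (each of the `4d` transported terms has size `≤ η⁻²|w|_τ`).
[cite: Balaban1985BackgroundPropagators, (3.23) p.394, (3.28) p.395] -/
theorem fnorm_covLap_single_le (hτp : ∀ a : 𝔸, a ≠ 0 → 0 < (τ (star a * a)).re) (hτt : ∀ a b : 𝔸, τ (a * b) = τ (b * a))
    (hτs : ∀ a : 𝔸, τ (star a) = starRingEnd ℂ (τ a)) (hU : ∀ (x : Site d) (κ : Fin d), U₀ x κ ∈ unitaryUnits 𝔸) (y : Site d) (w : 𝔸) (x : Site d) :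
    fnorm τ (covLap η U₀ (single y w) x) ≤ 4 * d * (η⁻¹) ^ 2 * fnorm τ w := by
  have hinv : ∀ (z : Site d) (κ : Fin d), (U₀ z κ)⁻¹ ∈ unitaryUnits 𝔸 := fun z κ => (unitaryUnits 𝔸).inv_mem (hU z κ)
  rw [covLap_apply]
  refine (fnorm_sum_le hτp hτs _ _).trans ?_
  have hterm : ∀ μ : Fin d, fnorm τ (η⁻¹ • (conjR (U₀ (x - e μ) μ)⁻¹ (η⁻¹ • (conjR (U₀ (x - e μ) μ) (single y w x) - single y w (x - e μ))) -
      η⁻¹ • (conjR (U₀ x μ) (single y w (x + e μ)) - single y w x))) ≤ 4 * (η⁻¹) ^ 2 * fnorm τ w := by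
    intro μ
    have hη : 0 ≤ |η⁻¹| := abs_nonneg _
    have h1 : fnorm τ (conjR (U₀ (x - e μ) μ)⁻¹ (η⁻¹ • (conjR (U₀ (x - e μ) μ) (single y w x) - single y w (x - e μ)))) ≤ |η⁻¹| * (fnorm τ w + fnorm τ w) := by
      rw [fnorm_conjR_of_unitary τ hτt (hinv _ _), fnorm_smul]
      refine mul_le_mul_of_nonneg_left ((fnorm_sub_le τ hτp hτs _ _).trans (add_le_add ?_ (fnorm_single_le τ y _ w))) hη
      rw [fnorm_conjR_of_unitary τ hτt (hU _ _)]; exact fnorm_single_le τ y _ w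
    have h2 : fnorm τ (η⁻¹ • (conjR (U₀ x μ) (single y w (x + e μ)) - single y w x)) ≤ |η⁻¹| * (fnorm τ w + fnorm τ w) := by
      rw [fnorm_smul]
      refine mul_le_mul_of_nonneg_left ((fnorm_sub_le τ hτp hτs _ _).trans (add_le_add ?_ (fnorm_single_le τ y _ w))) hη
      rw [fnorm_conjR_of_unitary τ hτt (hU _ _)]; exact fnorm_single_le τ y _ w
    rw [fnorm_smul]
    have h3 := fnorm_sub_le τ hτp hτs (conjR (U₀ (x - e μ) μ)⁻¹ (η⁻¹ • (conjR (U₀ (x - e μ) μ) (single y w x) - single y w (x - e μ))))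
      (η⁻¹ • (conjR (U₀ x μ) (single y w (x + e μ)) - single y w x))
    have habs : |η⁻¹| ^ 2 = (η⁻¹) ^ 2 := sq_abs _
    calc |η⁻¹| * fnorm τ (conjR (U₀ (x - e μ) μ)⁻¹ (η⁻¹ • (conjR (U₀ (x - e μ) μ) (single y w x) - single y w (x - e μ))) -
          η⁻¹ • (conjR (U₀ x μ) (single y w (x + e μ)) - single y w x))
        ≤ |η⁻¹| * (|η⁻¹| * (fnorm τ w + fnorm τ w) + |η⁻¹| * (fnorm τ w + fnorm τ w)) := mul_le_mul_of_nonneg_left (h3.trans (add_le_add h1 h2)) hη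
      _ = 4 * (η⁻¹) ^ 2 * fnorm τ w := by rw [← habs]; ring
  calc ∑ μ : Fin d, fnorm τ (η⁻¹ • (conjR (U₀ (x - e μ) μ)⁻¹ (η⁻¹ • (conjR (U₀ (x - e μ) μ) (single y w x) - single y w (x - e μ))) -
        η⁻¹ • (conjR (U₀ x μ) (single y w (x + e μ)) - single y w x)))
      ≤ ∑ μ : Fin d, 4 * (η⁻¹) ^ 2 * fnorm τ w := Finset.sum_le_sum fun μ _ => hterm μ
    _ = 4 * d * (η⁻¹) ^ 2 * fnorm τ w := by rw [Finset.sum_const, Finset.card_univ, Fintype.card_fin, nsmul_eq_mul]; ring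

end Laplacian

/-! ## §5  The blocks of `Ω₀Δ′_a(U₀)Ω₀`: range `Lᵐ`, block bound `4d∕η² + Σ_{j≤m} a_j` -/

section Blocks

variable {L : ℕ} {U₀ : Site d → Fin d → 𝔸ˣ} {η : ℝ} (τ : 𝔸 →ₗ[ℂ] ℂ) [FiniteDimensional ℝ 𝔸] (hτp : ∀ a : 𝔸, a ≠ 0 → 0 < (τ (star a * a)).re)
  {m : ℕ} {a : ℕ → ℝ} {Λ : ℕ → Finset (Site d)} {s : Finset (Site d)}

/-- the block of `Ω₀Δ′_a(U₀)Ω₀` spelled out: for `y ∈ Ω₀`, `T_{xy}w = 𝟙_{Ω₀}(x)·((Δ^η_{U₀}δ_y w)(x) + Σ_{j≤m} a_j (Q′_jᵀ Q′_j δ_y w)(x))`.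
[cite: Balaban1985BackgroundPropagators, (3.24) p.394] -/
theorem blockAt_deltaPrimeADom {y : Site d} (hy : y ∈ s) (w : 𝔸) (x : Site d) :
    blockAt s (deltaPrimeADom L U₀ η τ hτp m a Λ s) y w x =
      (↑s : Set (Site d)).indicator (fun x => covLap η U₀ (single y w) x + ∑ j ∈ Finset.range (m + 1),
        a j • transposeOn τ hτp (QprimeLin L U₀ j) (Λ j) (QprimeIter (zdBlocking d L) (bgT L U₀) j (single y w)) x) x := by
  rw [blockAt_def, deltaPrimeADom_coe, restrictSite_single_coe hy]
  congr 1
  funext z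
  exact deltaPrimeAZd_apply L U₀ η τ hτp m a Λ (single y w) z

/-- ★★ **RANGE `Lᵐ`**: `T_{xy}w = 0` for `|x − y|_∞ > Lᵐ` (`L ≥ 1`; the Laplacian needs `|x−y|_∞ ≤ 1`, the level-`j` penalty a common `j`-fold block index, i.e.
`|x − y|_∞ ≤ Lʲ − 1`). [cite: Balaban1985BackgroundPropagators, (3.24) p.394, (3.23) p.394, (3.19) p.393] -/
theorem blockAt_deltaPrimeADom_eq_zero (hτt : ∀ a b : 𝔸, τ (a * b) = τ (b * a)) (hτs : ∀ a : 𝔸, τ (star a) = starRingEnd ℂ (τ a)) (hL : 1 ≤ L)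
    (hT : ∀ j', j' < m → ∀ c x, bgT L U₀ j' c x ∈ unitaryUnits 𝔸) {y : Site d} (hy : y ∈ s) {x : Site d} (hx : x ∈ s) (w : 𝔸)
    (hfar : ((L ^ m : ℕ) : ℝ) < (linfDist x y : ℝ)) : blockAt s (deltaPrimeADom L U₀ η τ hτp m a Λ s) y w x = 0 := by
  have hfarN : L ^ m < linfDist x y := by exact_mod_cast hfar
  have hLm : 1 ≤ L ^ m := Nat.one_le_pow _ _ hL
  rw [blockAt_deltaPrimeADom τ hτp hy, Set.indicator_of_mem (Finset.mem_coe.mpr hx), covLap_single_eq_zero y w (by omega), zero_add]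
  refine Finset.sum_eq_zero fun j hj => ?_
  rw [Finset.mem_range] at hj
  have hjm : j ≤ m := by omega
  have hTj : ∀ j', j' < j → ∀ c x, bgT L U₀ j' c x ∈ unitaryUnits 𝔸 := fun j' hj' => hT j' (lt_of_lt_of_le hj' hjm)
  have hne : (blockMap L)^[j] x ≠ (blockMap L)^[j] y := by
    intro heq
    have h1 := linfDist_le_of_blockMap_iterate_eq hL j heq
    have h2 : L ^ j ≤ L ^ m := Nat.pow_le_pow_right hL hjm
    omega
  have h := fnorm_transposeOn_QprimeLin_single_le τ hτp hτt hτs hL hTj (Λ j) y w x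
  rw [if_neg hne] at h
  have h0 : fnorm τ (transposeOn τ hτp (QprimeLin L U₀ j) (Λ j) (QprimeIter (zdBlocking d L) (bgT L U₀) j (single y w)) x) = 0 :=
    le_antisymm h (fnorm_nonneg τ _)
  rw [(fnorm_eq_zero_iff hτp _).1 h0, smul_zero]

/-- ★★ **BLOCK BOUND `4d∕η² + Σ_{j≤m} a_j`**: `|T_{xy}w|_τ ≤ (4dη⁻² + Σ_{j≤m} a_j)·|w|_τ` (unitary `U₀`, unitary averaged transporters at the levels `< m`,
`a ≥ 0`, `L ≥ 1`). [cite: Balaban1985BackgroundPropagators, (3.24) p.394, (3.23) p.394, (3.19) p.393, (3.28) p.395] -/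
theorem fnorm_blockAt_deltaPrimeADom_le (hτt : ∀ a b : 𝔸, τ (a * b) = τ (b * a)) (hτs : ∀ a : 𝔸, τ (star a) = starRingEnd ℂ (τ a)) (hL : 1 ≤ L)
    (hU : ∀ (x : Site d) (κ : Fin d), U₀ x κ ∈ unitaryUnits 𝔸) (hT : ∀ j', j' < m → ∀ c x, bgT L U₀ j' c x ∈ unitaryUnits 𝔸)
    (ha : ∀ j, 0 ≤ a j) {y : Site d} (hy : y ∈ s) (x : Site d) (w : 𝔸) :
    fnorm τ (blockAt s (deltaPrimeADom L U₀ η τ hτp m a Λ s) y w x) ≤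
      (4 * d * (η⁻¹) ^ 2 + ∑ j ∈ Finset.range (m + 1), a j) * fnorm τ w := by
  by_cases hx : x ∈ s
  · rw [blockAt_deltaPrimeADom τ hτp hy, Set.indicator_of_mem (Finset.mem_coe.mpr hx)]
    refine (fnorm_add_le hτp hτs _ _).trans ?_
    rw [add_mul, Finset.sum_mul]
    refine add_le_add (fnorm_covLap_single_le τ hτp hτt hτs hU y w x) ((fnorm_sum_le hτp hτs _ _).trans (Finset.sum_le_sum fun j hj => ?_))
    rw [Finset.mem_range] at hj
    have hTj : ∀ j', j' < j → ∀ c x, bgT L U₀ j' c x ∈ unitaryUnits 𝔸 := fun j' hj' => hT j' (by omega)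
    rw [fnorm_smul, abs_of_nonneg (ha j)]
    refine mul_le_mul_of_nonneg_left ((fnorm_transposeOn_QprimeLin_single_le τ hτp hτt hτs hL hTj (Λ j) y w x).trans ?_) (ha j)
    split_ifs
    · exact le_rfl
    · exact fnorm_nonneg τ w
  · rw [blockAt_eq_zero_of_not_mem s _ y w hx, fnorm_zero]
    refine mul_nonneg (add_nonneg (by positivity) (Finset.sum_nonneg fun j _ => ha j)) (fnorm_nonneg τ w)

end Blocks

/-! ## §6  ★★★ The n = 0 entry of (3.42) for the genuine `G′(U₀)` from one coercivity constant -/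

section Decay

variable (L : ℕ) (U₀ : Site d → Fin d → 𝔸ˣ) (η : ℝ) (τ : 𝔸 →ₗ[ℂ] ℂ) [FiniteDimensional ℝ 𝔸]
  (hτp : ∀ a : 𝔸, a ≠ 0 → 0 < (τ (star a * a)).re) (m : ℕ) (a : ℕ → ℝ) (Λ : ℕ → Finset (Site d)) (s : Finset (Site d))

/-- ★★★ **[B9] THM 3.1's (3.42), n = 0 SHAPE, FOR THE GENUINE `G′(U₀)` AT THE `ℤᵈ` CARRIER, FROM ONE DISPLAYED COERCIVITY CONSTANT.**  Let `U₀` be a unitary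
background whose averaged transporters `Ū₀ʲ(Γ)` (`bgT`, levels `< m`) are unitary, `a ≥ 0`, `Ω₀ = s` finite, `0 < d`, `η ≠ 0`, `L ≥ 1`, `τ` faithful Hermitian
tracial on the finite-dimensional fibre, and suppose `Ω₀Δ′_a(U₀)Ω₀` is `c`-COERCIVE on `L²(Ω₀, ·)`: `c·⟨f,f⟩_τ ≤ ⟨f, Ω₀Δ′_a(U₀)Ω₀ f⟩_τ`.  Then for every `κ ≥ 0` with
`ϱ := (4dη⁻² + Σ_{j≤m} a_j)·(2Lᵐ+1)ᵈ·(e^{κLᵐ} − 1) < c`, every `y ∈ Ω₀`, `w`, and every site `x`: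
`|(G′(U₀) δ_y w)(x)|_τ ≤ e^{−κ|x − y|_∞}·|w|_τ ∕ (c − ϱ)`.
[cite: Balaban1985BackgroundPropagators, Thm 3.1 p.397, (3.42) p.397, (3.24) p.394, Thm 3.11 p.416; Balaban1984PropagatorsII, p.226] -/
theorem fnorm_GpZd_single_le_exp_of_coercive (hd : 0 < d) (hη : η ≠ 0) (hL : 1 ≤ L) (hτt : ∀ a b : 𝔸, τ (a * b) = τ (b * a))
    (hτs : ∀ a : 𝔸, τ (star a) = starRingEnd ℂ (τ a)) (hU : ∀ (x : Site d) (κ : Fin d), U₀ x κ ∈ unitaryUnits 𝔸)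
    (hT : ∀ j', j' < m → ∀ c x, bgT L U₀ j' c x ∈ unitaryUnits 𝔸) (ha : ∀ j, 0 ≤ a j) {c κ : ℝ} (hκ : 0 ≤ κ)
    (hco : ∀ f : suppSub (𝔸 := 𝔸) s, c * formE τ s f f ≤ formE τ s f (deltaPrimeADom L U₀ η τ hτp m a Λ s f))
    (hϱ : (4 * d * (η⁻¹) ^ 2 + ∑ j ∈ Finset.range (m + 1), a j) * ((2 * L ^ m + 1) ^ d : ℕ) * (Real.exp (κ * (L ^ m : ℕ)) - 1) < c)
    {y : Site d} (hy : y ∈ s) (w : 𝔸) (x : Site d) :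
    fnorm τ ((GpZd L U₀ η τ hτp m a Λ s hd hη hτt hτs hU ha (restrictSite s (single y w)) : Site d → 𝔸) x) ≤
      Real.exp (-(κ * (linfDist x y : ℝ))) /
          (c - (4 * d * (η⁻¹) ^ 2 + ∑ j ∈ Finset.range (m + 1), a j) * ((2 * L ^ m + 1) ^ d : ℕ) * (Real.exp (κ * (L ^ m : ℕ)) - 1)) *
        fnorm τ w := by
  refine fnorm_inv_single_le_exp_of_coercive (T := deltaPrimeADom L U₀ η τ hτp m a Λ s) hτp hτs
    (dist := fun x y => (linfDist x y : ℝ)) (fun x => by simp) (fun x y => by rw [LatticeNorms.linfDist_comm])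
    (fun x y z => by exact_mod_cast LatticeNorms.linfDist_triangle x y z) (by positivity)
    (add_nonneg (by positivity) (Finset.sum_nonneg fun j _ => ha j)) hκ (fun x hx => ?_) (fun y hy x hx w hfar => ?_) (fun y hy x hx w => ?_) hco hϱ
    (fun h => GpZd L U₀ η τ hτp m a Λ s hd hη hτt hτs hU ha h) (fun h => deltaPrimeADom_GpZd hd hη hτt hτs hU ha h) hy w x
  · -- ball count
    have h := card_filter_linfDist_le s x (L ^ m)
    refine le_trans (le_of_eq (congrArg Finset.card (Finset.filter_congr fun y _ => ?_))) h
    simp only [Nat.cast_le]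
  · exact blockAt_deltaPrimeADom_eq_zero τ hτp hτt hτs hL hT hy hx w hfar
  · exact fnorm_blockAt_deltaPrimeADom_le τ hτp hτt hτs hL hU hT ha hy x w

/-- ★★★ **THE SAME ON dag-n06-w2 g3's REGIME `𝒰′ = {U₀ unitary ∧ (1.7) on ℤᵈ at the window α_Q∕L²}`**: there the averaged transporters `Ū₀ʲ(Γ)` are unitary for
`j ≤ m` ([5] Prop. 2 — dag-n06-w4 g3's `bgT_mem_unitaryUnits_of_reg17UnivP`; `2 ≤ L`, `0 < d`), so the coercivity constant `c` is the ONLY displayed input.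
[cite: Balaban1985BackgroundPropagators, Thm 3.1 p.397, (3.42) p.397, Thm 3.11 p.416; Balaban1985Averaging, Prop. 2 p.26; Balaban1985RegularSpaces, (1.7) p.77] -/
theorem fnorm_GpZd_single_le_exp_of_coercive_of_reg17UnivP [Nontrivial 𝔸] (hd : 0 < d) (hη : η ≠ 0) (hL : 2 ≤ L) (hτt : ∀ a b : 𝔸, τ (a * b) = τ (b * a))
    (hτs : ∀ a : 𝔸, τ (star a) = starRingEnd ℂ (τ a)) (hU : ∀ (x : Site d) (κ : Fin d), U₀ x κ ∈ unitaryUnits 𝔸)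
    (hreg : Reg17 L m (fun _ => (Set.univ : Set (Site d))) (alphaQ d L / (L : ℝ) ^ 2) U₀) (ha : ∀ j, 0 ≤ a j) {c κ : ℝ} (hκ : 0 ≤ κ)
    (hco : ∀ f : suppSub (𝔸 := 𝔸) s, c * formE τ s f f ≤ formE τ s f (deltaPrimeADom L U₀ η τ hτp m a Λ s f))
    (hϱ : (4 * d * (η⁻¹) ^ 2 + ∑ j ∈ Finset.range (m + 1), a j) * ((2 * L ^ m + 1) ^ d : ℕ) * (Real.exp (κ * (L ^ m : ℕ)) - 1) < c)
    {y : Site d} (hy : y ∈ s) (w : 𝔸) (x : Site d) :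
    fnorm τ ((GpZd L U₀ η τ hτp m a Λ s hd hη hτt hτs hU ha (restrictSite s (single y w)) : Site d → 𝔸) x) ≤
      Real.exp (-(κ * (linfDist x y : ℝ))) /
          (c - (4 * d * (η⁻¹) ^ 2 + ∑ j ∈ Finset.range (m + 1), a j) * ((2 * L ^ m + 1) ^ d : ℕ) * (Real.exp (κ * (L ^ m : ℕ)) - 1)) *
        fnorm τ w :=
  fnorm_GpZd_single_le_exp_of_coercive L U₀ η τ hτp m a Λ s hd hη (le_trans one_le_two hL) hτt hτs hU
    (fun j' hj' c x => B9Thm311PosDefNearFlatZd.bgT_mem_unitaryUnits_of_reg17UnivP hd hL m hU hreg j' hj'.le c x) ha hκ hco hϱ hy w x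

end Decay

end Literature.MathematicalPhysics.QuantumFieldTheory.Balaban1983to89.B9Thm31GpDecayOfCoerciveZd

end
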